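import Mathlib
import Summits.Parity.BatemanHorn.Theorems.IsogenyRedeiSplitBlockJacobiWeylDefs

/-!
# Sketch — crux `SplitBlockJacobiCorner` (stmt-Parity-15002), idea `cauchy-free-twisted-type-i2`
(crux-ideate round 1, ideator 2).  First-lemma signatures only; proofs are `sorry`.

* `gauss_coordinate_split` — tool T0: in Gaussian coordinates `Q = a² + b²` of the OUTER prime the
  root phase `e(h ν_Q · n⁻¹ / Q)` (ν_Q ≡ a·b⁻¹ the root of −1 attached to `a+bi`) factors EXACTLY as a
  Duke–Friedlander–Iwaniec Kloosterman fraction `e(−h · (a n)⁻¹ / b)` (fixed numerator, modulus the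
  coordinate `b`, variable `a·n`) times a phase periodic in `(a,b)` modulo `n` and a negligible
  archimedean factor.  Checked numerically (exp/split_check.py: 2277 cases, max error 1e-10).
* `smoothTwistedSum`, `SmoothTwistedTypeI2` — the line's load-bearing OPEN statement K1: power saving for
  the Jacobi-twisted root Weyl sum with BOTH moduli FREE (no primality), near-balanced boxes, small
  auxiliary level `L` and frequency `k` (Merikoski's "Type I₂", twisted).
* `MixedBilinearBalanced` — drefute-g2's repaired corner hypothesis, restated over `twistedSum`.
* `ShortFactorTwistedTypeII` — K2: the Merikoski-range companion (one factor ≤ x^{0.26}).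
* `mbb_of_typeI2_typeII` — the reduction the crux-plan must make precise (Heath-Brown identity in both
  prime variables): K1 ∧ K2 ⇒ MBB(δ₀) for some δ₀ > 0, whence the corner by the LANDED
  `tierWeylBound_of_mixedBilinearBalanced` + stubs 1–4 of line cofactor-root-discrepancy.
-/

noncomputable section

open Complex Finset

namespace Summit.Parity.BatemanHorn.Cruxes.SplitBlockJacobiCorner.Sketch

open Summit.Parity.BatemanHorn.Cruxes.SplitBlockJacobi.CofactorRootDiscrepancy

/-- `e(x) = exp(2π i x)` for real `x`. -/
def e (x : ℝ) : ℂ := Complex.exp (2 * Real.pi * Complex.I * (x : ℂ))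

/-- **T0 (Gauss-coordinate split of the root phase).**  Let `Q = a² + b²` with `0 < b`,
`gcd(b, a·n) = 1`, `gcd(n, Q) = 1`.  Put `ν := a·b⁻¹ (mod Q)` (a root of `−1` mod `Q`), `n̄ := n⁻¹ (mod Q)`,
`u := (a n)⁻¹ (mod b)`, `v := (b Q)⁻¹ (mod n)` (least non-negative residues).  Then
`e(h ν n̄ / Q) = e(−h u / b) · e(−h a v / n) · e(h a / (b n Q))`.
(Elementary: solve `b n X ≡ a (mod Q)` as `X = (a + Q y)/(b n)`, `y ≡ −a Q⁻¹ (mod b n)`, and split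
`1/(b n)` by CRT.)  [folklore; DFI 1995 (2.3)-type Gauss correspondence with conductor `n`] -/
theorem gauss_coordinate_split (a : ℤ) (b Q n : ℕ) (h : ℤ) (hb : 0 < b) (hn : 0 < n)
    (hQ : (Q : ℤ) = a ^ 2 + (b : ℤ) ^ 2) (hcop : Int.gcd ((b : ℤ)) (a * n) = 1)
    (hnQ : Nat.Coprime n Q) :
    let ν : ℕ := ((a : ZMod Q) * ((b : ZMod Q))⁻¹).val
    let nbar : ℕ := ((n : ZMod Q)⁻¹).val
    let u : ℕ := (((a * n : ℤ) : ZMod b)⁻¹).val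
    let v : ℕ := (((b * Q : ℕ) : ZMod n)⁻¹).val
    e ((h * ν * nbar : ℤ) / (Q : ℝ)) =
      e (-((h * u : ℤ) : ℝ) / (b : ℝ)) * e (-((h * a * v : ℤ) : ℝ) / (n : ℝ)) *
        e ((h * a : ℤ) / ((b : ℝ) * n * Q)) := by
  sorry

/-- The SMOOTH twisted sum: both moduli `n, q ≡ 1 (mod 4)` FREE in dyadic boxes (no primality),
Jacobi twist `(n|q)`, root Weyl sum of `−1` modulo `L·n·q` at frequency `k`. -/
def smoothTwistedSum (k : ℤ) (L N₁ N₂ : ℕ) : ℂ :=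
  ∑ n ∈ (Finset.Ioc N₁ (2 * N₁)).filter (fun n : ℕ => n % 4 = 1),
    ∑ q ∈ (Finset.Ioc N₂ (2 * N₂)).filter (fun q : ℕ => q % 4 = 1 ∧ Nat.Coprime n q),
      (jacobiSym (n : ℤ) q : ℂ) * rootWeylSum k (L * n * q)

/-- **K1 `SmoothTwistedTypeI2 η`** (the bet; Merikoski's open "Type I₂", Jacobi-twisted): a power saving
`(N₁N₂)^{−η}` for `smoothTwistedSum` in near-balanced boxes `N₁ ≤ N₂ ≤ N₁^{1+η}`, uniformly for
auxiliary levels `1 ≤ L ≤ N₁^η` and frequencies `0 < |k| ≤ N₁^η`. -/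
def SmoothTwistedTypeI2 (η : ℝ) : Prop :=
  ∃ N₀ : ℕ, ∀ N₁ N₂ L : ℕ, N₀ ≤ N₁ → N₁ ≤ N₂ → (N₂ : ℝ) ≤ (N₁ : ℝ) ^ (1 + η) →
    1 ≤ L → (L : ℝ) ≤ (N₁ : ℝ) ^ η →
      ∀ k : ℤ, k ≠ 0 → (|k| : ℝ) ≤ (N₁ : ℝ) ^ η →
        ‖smoothTwistedSum k L N₁ N₂‖ ≤ ((N₁ * N₂ : ℕ) : ℝ) ^ (1 - η)

/-- **K2 `ShortFactorTwistedTypeII η`** (Merikoski-range Type II with the Jacobi twist carried as a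
cross character): for `M ≤ (N₁N₂)^{13/100}` (inside Merikoski's `N ≤ x^{(57−32α)/96}` at `α = 1+`),
arbitrary unit coefficients `aₘ` on the short factor and `β` on the long co-variable, the twisted root
sum over moduli `(m·f)·q` saves a power.  Typed in the simplest shape the reduction needs. -/
def ShortFactorTwistedTypeII (η : ℝ) : Prop :=
  ∃ N₀ : ℕ, ∀ N₁ N₂ M : ℕ, N₀ ≤ N₁ → N₁ ≤ N₂ → (N₂ : ℝ) ≤ (N₁ : ℝ) ^ (1 + η) →
    (N₁ : ℝ) ^ η ≤ M → (M : ℝ) ≤ ((N₁ * N₂ : ℕ) : ℝ) ^ (13 / 100 : ℝ) →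
      ∀ (am : ℕ → ℂ) (β : ℕ → ℂ), (∀ m, ‖am m‖ ≤ 1) → (∀ q, ‖β q‖ ≤ 1) →
        ∀ k : ℤ, k ≠ 0 → (|k| : ℝ) ≤ (N₁ : ℝ) ^ η →
          ‖∑ m ∈ Finset.Ioc M (2 * M), ∑ f ∈ Finset.Ioc (N₁ / (2 * M)) (2 * N₁ / M),
              ∑ q ∈ (Finset.Ioc N₂ (2 * N₂)).filter (fun q : ℕ => q % 4 = 1 ∧ Nat.Coprime (m * f) q),
                am m * β q * (jacobiSym ((m * f : ℕ) : ℤ) q : ℂ) * rootWeylSum k (m * f * q)‖ ≤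
            ((N₁ * N₂ : ℕ) : ℝ) ^ (1 - η)

/-- drefute-g2's REPAIRED corner hypothesis `MixedBilinearBalanced δ₀` (aspect-bounded), over the landed
vocabulary `twistedSum` (= Σ_{Q,Q' prime ≡ 1 (4)} (Q|Q')·S(h,QQ')). -/
def MixedBilinearBalanced (δ₀ : ℝ) : Prop :=
  ∃ P₀ : ℕ, ∀ P₁ P₁' P₂ P₂' : ℕ, P₀ ≤ P₁ → P₁ ≤ P₁' → P₁' ≤ 2 * P₁ → P₁ ≤ P₂ → P₂ ≤ P₂' →
    P₂' ≤ 2 * P₂ → (P₂ : ℝ) ≤ 8 * (P₁ : ℝ) ^ (1 + δ₀) →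
      ∀ h : ℤ, h ≠ 0 → (|h| : ℝ) ≤ ((P₁ * P₂ : ℕ) : ℝ) ^ δ₀ →
        ‖twistedSum h P₁ P₁' P₂ P₂'‖ ≤ ((P₁ * P₂ : ℕ) : ℝ) ^ (1 - δ₀)

/-- **Reduction (to be made precise by crux-plan): Heath-Brown's identity applied to BOTH prime
indicators of `twistedSum` expresses it through smooth twisted Type-I₂ pieces (all free variables,
Möbius cofactors ≤ x^ε inside the level `L`) and short-factor Type-II pieces; hence K1 ∧ K2 ⇒ MBB.**
[difficulty L–XL; standard combinatorics + the two inputs] -/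
theorem mbb_of_typeI2_typeII :
    (∃ η : ℝ, 0 < η ∧ SmoothTwistedTypeI2 η ∧ ShortFactorTwistedTypeII η) →
      ∃ δ₀ : ℝ, 0 < δ₀ ∧ δ₀ ≤ 1 ∧ MixedBilinearBalanced δ₀ := by
  sorry

end Summit.Parity.BatemanHorn.Cruxes.SplitBlockJacobiCorner.Sketch

end
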